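import Literature.Topology.FourManifolds.AttachmentBoundarySurgery
import Literature.Topology.FourManifolds.LinkSurgeryUniqueness
import HarnessLib

/-!
# The boundary of `D⁴ ∪_{h̄} (2-handles)` is presented as surgery on the framed link (Kirby I §5)

Topic `Literature/Topology/FourManifolds`; the link version of `AttachmentBoundarySurgery.lean`
(Kirby 1989, Ch. I Lemma 2.1 for ONE handle: `HandleAttachingMap.isOpenGluing_boundary`).

**Theorem** (`isSurgeryPresentation_boundary_of_isMultiAttachment`; Kirby 1989, Ch. I §5 "the
`3`-manifold `N³ = ∂M_L` is obtained from `S³` by surgery on the framed link `L`", Ch. I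
Lemma 2.1; Gompf–Stipsicz 1999, §5.3 / Prop. 5.1.2).  Let `gᵢ : T → D⁴` (`i : ι`, finite) be
attaching maps of 2-handles whose values on the unit disc bundle of `T ∩ ∂D⁴` are oriented tubular
neighbourhoods `νᵢ` of the components `Lᵢ` of a link `L ⊂ S³ = ∂D⁴`
(`gᵢ y = incl (νᵢ (angle y, fibre y))` for `y` of depth `0`), and let `P` be `D⁴` with the
handles attached along the `gᵢ` (`HandleAttachingMap.IsMultiAttachment g (𝓡∂ 4) P`).  Then for
every boundary datum `bP` of `P` the boundary `∂P = bP.carrier` **is surgery on `L` presented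
with the very tubes `νᵢ`** (`Link.IsSurgeryPresentation (𝓡 3) bP.carrier ν`,
`LinkSurgeryUniqueness.lean`): an open smooth embedding of the link complement `S³ ∖ L` and one
open solid torus `D̊² × S¹` per component, pairwise disjoint, covering `∂P`, the `i`-th torus
glued to the complement along `Link.surgeryRel ν i`.

Proof: word for word the one-handle proof.  §1 generalises the parametrisation of the boundary
of the carved piece (`AttachmentBoundaryPieces.lean`, §1) from the knot complement and
`D⁴ ∖ h̄(S)` to the link complement and `D⁴ ∖ ⋃ᵢ gᵢ(S)` (`linkComplementPt`, with its smooth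
left inverse `linkComplementInv`); §2 restricts the open embeddings of `P` to the boundary
(`OpenEmbeddingBoundaryRestrict.lean`) and reads Kosinski's relation `x ∼ h̄ᵢ α x` on `∂D⁴` as
`surgeryRel νᵢ` by the one-handle lemma `HandleAttachingMap.glueRel_incl_beltBoundaryPt_iff`;
the solid tori are disjoint because the handle pieces are.  The framing integers and the
disjointness of the FULL tubes `range νᵢ` demanded by `IsIntegralSurgeryLink` are not part of a
presentation and are supplied by the consumer (`FramedLinkTraceBoundary.lean`).  Everything here
is proved; no named facts are introduced.

## References

* R. C. Kirby, *The Topology of 4-Manifolds*, LNM 1374 (1989), Ch. I §2 Lemma 2.1, §5. [Kirby1989]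
* R. E. Gompf, A. I. Stipsicz, *4-Manifolds and Kirby Calculus* (1999), §5.3. [GompfStipsicz1999]
* A. A. Kosinski, *Differential Manifolds*, Academic Press (1993), VI §6. [Kosinski1993]
-/

open scoped Manifold ContDiff Topology
open Set Function Metric Filter Real

noncomputable section

namespace Literature.Topology.FourManifolds

universe u v

/-- Local notation: `𝔼 n` is the model Euclidean space `EuclideanSpace ℝ (Fin n)`. -/
local notation "𝔼 " n:arg => EuclideanSpace ℝ (Fin n)

/-- Local notation: `𝕊 n` is the unit sphere in `EuclideanSpace ℝ (Fin (n + 1))`. -/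
local notation "𝕊 " n:arg => (Metric.sphere (0 : EuclideanSpace ℝ (Fin (n + 1))) 1)

/-- Local notation: `𝔻 n` is the closed unit ball in `EuclideanSpace ℝ (Fin n)`. -/
local notation "𝔻 " n:arg => (Metric.closedBall (0 : EuclideanSpace ℝ (Fin n)) 1)

set_option quotPrecheck false in
/-- Local notation: Kosinski's tube `T ⊆ D⁴` of the circle `S¹ × 0`, as a type. -/
local notation "𝕋" => ↥(handleTube 3 2)

set_option quotPrecheck false in
/-- Local notation: the inclusion `S³ ↪ D⁴` of the boundary datum of the 4-disc. -/
local notation "ι₃" => (closedBallBoundaryData 3).incl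

attribute [local instance] fact_finrank_euclideanSpace_succ

section Link

variable {ι : Type u} [Finite ι] (g : ι → HandleAttachingMap 3 2 (𝔻 4)) {L : Link ι}
  (ν : ∀ i, Knot.TubularNbhd ⇑(L.component i))
  (hbd : ∀ (i : ι) (y : 𝕋), tubeDepth y = 0 →
    (g i).toFun y = ι₃ (ν i (tubeAngle y, tubeFibre y)))

/-! ### §1 The link complement parametrises `∂(D⁴ ∖ ⋃ᵢ gᵢ(S))` -/

include hbd in
/-- **`incl x ∈ D⁴ ∖ ⋃ᵢ gᵢ(S)` iff `x ∈ S³ ∖ L`** (the attaching circle of `gᵢ` is `Lᵢ`).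
[cite: Kosinski1993, VI §6] -/
theorem incl_mem_coresComplement_iff_mem_complement (x : 𝕊 3) :
    ι₃ x ∈ HandleAttachingMap.coresComplement g ↔ x ∈ L.complement := by
  rw [HandleAttachingMap.mem_coresComplement, Link.mem_complement_iff]
  refine forall_congr' fun i => ?_
  rw [(g i).mem_core_iff_of_boundaryValues (ν i) (hbd i)]
  constructor
  · rintro h ⟨θ, hθ⟩
    exact h ⟨θ, by rw [hθ]⟩
  · rintro h ⟨θ, hθ⟩
    exact h ⟨θ, ((closedBallBoundaryData 3).injective_incl hθ).symm⟩

/-- **The parametrisation `S³ ∖ L → D⁴ ∖ ⋃ᵢ gᵢ(S)`, `x ↦ incl x`.** [cite: Kirby1989, Ch. I §5] -/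
def linkComplementPt (x : ↥L.complement) : ↥(HandleAttachingMap.coresComplement g) :=
  ⟨ι₃ x.1, (incl_mem_coresComplement_iff_mem_complement g ν hbd x.1).2 x.2⟩

/-- Its value in `D⁴`. [folklore] -/
@[simp] theorem coe_linkComplementPt (x : ↥L.complement) :
    (linkComplementPt g ν hbd x).1 = ι₃ x.1 := rfl

/-- It is smooth. [folklore] -/
theorem contMDiff_linkComplementPt : ContMDiff (𝓡 3) (𝓡∂ 4) ∞ (linkComplementPt g ν hbd) := by
  rw [← ContMDiff.subtypeVal_comp_iff]
  exact (closedBallBoundaryData 3).isSmoothEmbedding.contMDiff.comp contMDiff_subtype_val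

/-- It is injective. [folklore] -/
theorem injective_linkComplementPt : Injective (linkComplementPt g ν hbd) := fun _ _ h =>
  Subtype.ext ((closedBallBoundaryData 3).injective_incl (congrArg Subtype.val h))

/-- Its values are boundary points. [folklore] -/
theorem linkComplementPt_mem_boundary (x : ↥L.complement) :
    linkComplementPt g ν hbd x ∈
      (𝓡∂ 4).boundary ↥(HandleAttachingMap.coresComplement g) := by
  rw [mem_boundary_opens_iff, coe_linkComplementPt, ← (closedBallBoundaryData 3).range_incl]
  exact mem_range_self _

/-- **Every boundary point of `D⁴ ∖ ⋃ᵢ gᵢ(S)` comes from `S³ ∖ L`.** [folklore] -/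
theorem mem_range_linkComplementPt {a : ↥(HandleAttachingMap.coresComplement g)}
    (ha : a ∈ (𝓡∂ 4).boundary ↥(HandleAttachingMap.coresComplement g)) :
    a ∈ range (linkComplementPt g ν hbd) := by
  rw [mem_boundary_opens_iff, ← (closedBallBoundaryData 3).range_incl] at ha
  obtain ⟨x, hx⟩ := ha
  have hx' : x ∈ L.complement :=
    (incl_mem_coresComplement_iff_mem_complement g ν hbd x).1 (hx ▸ a.2)
  exact ⟨⟨x, hx'⟩, Subtype.ext hx⟩

/-- **Images of open sets are open pieces of the boundary.** [folklore] -/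
theorem exists_image_linkComplementPt_eq {U : Set ↥L.complement} (hU : IsOpen U) :
    ∃ W : Set ↥(HandleAttachingMap.coresComplement g), IsOpen W ∧
      linkComplementPt g ν hbd '' U =
        W ∩ (𝓡∂ 4).boundary ↥(HandleAttachingMap.coresComplement g) := by
  -- adapted from `HandleAttachingMap.exists_image_complementPt_eq` (AttachmentBoundaryPieces.lean)
  obtain ⟨U₁, hU₁, rfl⟩ := isOpen_induced_iff.1 hU
  obtain ⟨W₀, hW₀, hW₀U⟩ :=
    (closedBallBoundaryData 3).isSmoothEmbedding.isEmbedding.isInducing.isOpen_iff.1 hU₁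
  refine ⟨Subtype.val ⁻¹' W₀, hW₀.preimage continuous_subtype_val, ?_⟩
  ext a
  constructor
  · rintro ⟨x, hx, rfl⟩
    refine ⟨?_, linkComplementPt_mem_boundary g ν hbd x⟩
    show ι₃ x.1 ∈ W₀
    have : x.1 ∈ ι₃ ⁻¹' W₀ := by rw [hW₀U]; exact hx
    exact this
  · rintro ⟨haW, hab⟩
    obtain ⟨x, rfl⟩ := mem_range_linkComplementPt g ν hbd hab
    refine ⟨x, ?_, rfl⟩
    show x.1 ∈ U₁
    rw [← hW₀U]
    exact haW

open Classical in
/-- **The left inverse `D⁴ ∖ ⋃ᵢ gᵢ(S) → S³ ∖ L`** (meaningful on the boundary): `incl⁻¹`, with a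
junk value off the good set. [folklore] -/
def linkComplementInv [Nonempty ↥L.complement] (a : ↥(HandleAttachingMap.coresComplement g)) :
    ↥L.complement :=
  if h : (closedBallBoundaryData 3).inclInv a.1 ∈ L.complement then ⟨_, h⟩
  else Classical.arbitrary _

/-- `linkComplementInv ∘ linkComplementPt = id`. [folklore] -/
theorem linkComplementInv_linkComplementPt [Nonempty ↥L.complement] (x : ↥L.complement) :
    linkComplementInv g (L := L) (linkComplementPt g ν hbd x) = x := by
  have h1 : (closedBallBoundaryData 3).inclInv (linkComplementPt g ν hbd x).1 = x.1 := by
    rw [coe_linkComplementPt, (closedBallBoundaryData 3).inclInv_incl]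
  have h2 : (closedBallBoundaryData 3).inclInv (linkComplementPt g ν hbd x).1 ∈ L.complement := by
    rw [h1]; exact x.2
  unfold linkComplementInv
  rw [dif_pos h2]
  exact Subtype.ext h1

include hbd in
/-- **The left inverse is smooth on the boundary.** [folklore] -/
theorem contMDiffOn_linkComplementInv [Nonempty ↥L.complement] :
    ContMDiffOn (𝓡∂ 4) (𝓡 3) ∞ (linkComplementInv g (L := L))
      ((𝓡∂ 4).boundary ↥(HandleAttachingMap.coresComplement g)) := by
  -- adapted from `HandleAttachingMap.contMDiffOn_complementInv` (AttachmentBoundaryPieces.lean)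
  intro a ha
  rw [← ContMDiffWithinAt.subtypeVal_comp_iff]
  have hF : ContMDiffOn (𝓡∂ 4) (𝓡 3) ∞
      (fun a : ↥(HandleAttachingMap.coresComplement g) => (closedBallBoundaryData 3).inclInv a.1)
      ((𝓡∂ 4).boundary ↥(HandleAttachingMap.coresComplement g)) := by
    refine (closedBallBoundaryData 3).contMDiffOn_inclInv.comp contMDiff_subtype_val.contMDiffOn ?_
    intro a ha
    rw [mem_boundary_opens_iff, ← (closedBallBoundaryData 3).range_incl] at ha
    exact ha
  refine (hF a ha).congr (fun a' ha' => ?_) ?_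
  · obtain ⟨x, rfl⟩ := mem_range_linkComplementPt g ν hbd ha'
    rw [comp_apply, linkComplementInv_linkComplementPt g ν hbd, coe_linkComplementPt,
      (closedBallBoundaryData 3).inclInv_incl]
  · obtain ⟨x, rfl⟩ := mem_range_linkComplementPt g ν hbd ha
    rw [comp_apply, linkComplementInv_linkComplementPt g ν hbd, coe_linkComplementPt,
      (closedBallBoundaryData 3).inclInv_incl]

include hbd in
/-- **The link complement is nonempty** when the attaching maps have pairwise disjoint ranges: a
point `νᵢ (θ, w)` with `0 < ‖w‖ < 1` lies off `Lᵢ` and in the range of `gᵢ`, hence off the other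
attaching circles. [folklore] -/
theorem nonempty_linkComplement
    (hdisj : Pairwise fun i j => Disjoint (range (g i).toFun) (range (g j).toFun)) :
    Nonempty ↥L.complement := by
  rcases isEmpty_or_nonempty ι with hι | ⟨⟨i₀⟩⟩
  · refine ⟨⟨⟨EuclideanSpace.single 0 1, by
      rw [mem_sphere_zero_iff_norm, PiLp.norm_single, norm_one]⟩, ?_⟩⟩
    rw [Link.mem_complement_iff]
    exact fun i => isEmptyElim i
  · set w₀ : 𝔼 2 := (1 / 2 : ℝ) • (unitVec₂ : 𝔼 2) with hw₀
    have hnw : ‖w₀‖ = 1 / 2 := by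
      rw [hw₀, norm_smul, norm_eq_of_mem_sphere unitVec₂, mul_one, Real.norm_of_nonneg (by norm_num)]
    have hw0 : w₀ ≠ 0 := by
      rw [← norm_ne_zero_iff, hnw]; norm_num
    have hpos : 0 < 1 - 0 - ‖w₀‖ ^ 2 := by rw [hnw]; norm_num
    set θ₀ : 𝕊 1 := unitVec₂
    refine ⟨⟨ν i₀ (θ₀, w₀), ?_⟩⟩
    rw [Link.mem_complement_iff]
    intro j hj
    by_cases hji : j = i₀
    · subst hji
      exact (ν j).apply_mem_compl_range hw0 hj
    · obtain ⟨θ, hθ⟩ := hj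
      have h1 : (g i₀).toFun (mkTubePt θ₀ w₀ 0 le_rfl hpos) = ι₃ (ν i₀ (θ₀, w₀)) := by
        rw [hbd i₀ _ (tubeDepth_mkTubePt _ _ _ _ _), tubeAngle_mkTubePt, tubeFibre_mkTubePt]
      have h2 : (g j).toFun (coreTubePt θ) = ι₃ (ν i₀ (θ₀, w₀)) := by
        rw [(g j).apply_coreTubePt_eq (ν j) (hbd j) θ, hθ]
      exact Set.disjoint_left.1 (hdisj hji) ⟨coreTubePt θ, h2⟩ ⟨_, h1⟩

/-! ### §2 The boundary of the multi-attachment is presented as surgery on `L` -/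

include hbd in
/-- **The boundary of `D⁴ ∪ (2-handles along L)` is `S³` surgered along the tubes `νᵢ`**
(Kirby 1989, Ch. I §5: `N³ = ∂M_L`; Lemma 2.1), for every boundary datum `bP` of `P`:
`bP.carrier` is surgery on `L` presented with the tubular neighbourhoods `ν`
(`Link.IsSurgeryPresentation`). [cite: Kirby1989, Ch. I §5] -/
theorem isSurgeryPresentation_boundary_of_isMultiAttachment {P : Type v} [TopologicalSpace P]
    [ChartedSpace (EuclideanHalfSpace 4) P] [IsManifold (𝓡∂ 4) ∞ P]
    (hg : HandleAttachingMap.IsMultiAttachment g (𝓡∂ 4) P)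
    (bP : BoundaryData (𝓡∂ 4) P (𝓡 3)) :
    L.IsSurgeryPresentation (𝓡 3) bP.carrier ν := by
  -- adapted from `HandleAttachingMap.isOpenGluing_boundary` (AttachmentBoundarySurgery.lean)
  obtain ⟨hgdisj, jA, jB, hjA, hjAo, hjB, hcov, hglue, hBdisj⟩ := hg
  haveI : Nonempty ↥L.complement := nonempty_linkComplement g ν hbd hgdisj
  haveI : Nonempty ↥solidTorus := ⟨solidTorusBasePt⟩
  obtain ⟨x₀⟩ := (inferInstance : Nonempty ↥L.complement)
  -- `∂P` is nonempty: it contains the image of a point of `S³ ∖ L`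
  haveI : Nonempty bP.carrier := by
    have hb := BoundaryData.apply_mem_boundary hjA hjAo (linkComplementPt_mem_boundary g ν hbd) x₀
    rw [← bP.range_incl] at hb
    obtain ⟨z, -⟩ := hb
    exact ⟨z⟩
  -- the restricted embeddings
  set jA₀ := bP.boundaryRestrict jA (linkComplementPt g ν hbd) with hjA₀
  set jB₀ := fun i => bP.boundaryRestrict (jB i) beltBoundaryPt with hjB₀
  obtain ⟨hA, hAo⟩ := bP.isSmoothEmbedding_boundaryRestrict hjA hjAo
    (linkComplementPt_mem_boundary g ν hbd) (contMDiff_linkComplementPt g ν hbd)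
    (injective_linkComplementPt g ν hbd) (fun U hU => exists_image_linkComplementPt_eq g ν hbd hU)
    (linkComplementInv_linkComplementPt g ν hbd) (contMDiffOn_linkComplementInv g ν hbd)
  have eL : ((𝔼 2) × EuclideanSpace ℝ (Fin 1)) ≃L[ℝ] 𝔼 3 := ContinuousLinearEquiv.ofFinrankEq (by simp)
  have hB : ∀ i, Manifold.IsSmoothEmbedding (𝓘(ℝ, 𝔼 2).prod (𝓡 1)) (𝓡 3) ∞ (jB₀ i) ∧
      IsOpen (range (jB₀ i)) := fun i =>
    bP.isSmoothEmbedding_boundaryRestrict_of_boundaryless (hjB i).1 (hjB i).2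
      beltBoundaryPt_mem_boundary contMDiff_beltBoundaryPt eL injective_beltBoundaryPt
      (fun U hU => exists_image_beltBoundaryPt_eq hU) beltBoundaryInv_beltBoundaryPt
      (contMDiffOn_beltBoundaryInv.mono boundary_subset_good)
  have hinclA : ∀ x, bP.incl (jA₀ x) = jA (linkComplementPt g ν hbd x) := fun x =>
    bP.incl_boundaryRestrict hjA hjAo (linkComplementPt_mem_boundary g ν hbd) x
  have hinclB : ∀ i b, bP.incl (jB₀ i b) = jB i (beltBoundaryPt b) := fun i b =>
    bP.incl_boundaryRestrict (hjB i).1 (hjB i).2 beltBoundaryPt_mem_boundary b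
  refine ⟨jA₀, jB₀, hA, hAo, hB, ?_, ?_, fun i x b => ?_⟩
  · -- cover: a point of `∂P` is `jA a` or `jB i b` with `a`, `b` boundary points of the pieces
    refine eq_univ_of_forall fun z => ?_
    have hz : bP.incl z ∈ range jA ∪ ⋃ i, range (jB i) := by rw [hcov]; exact mem_univ _
    rcases hz with ⟨a, ha⟩ | hz
    · exact Or.inl (bP.mem_range_boundaryRestrict hjA hjAo (linkComplementPt_mem_boundary g ν hbd)
        (fun a ha => mem_range_linkComplementPt g ν hbd ha) ha.symm)
    · obtain ⟨i, b, hb⟩ := mem_iUnion.1 hz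
      exact Or.inr (mem_iUnion.2 ⟨i, bP.mem_range_boundaryRestrict (hjB i).1 (hjB i).2
        beltBoundaryPt_mem_boundary (fun b hb => mem_range_beltBoundaryPt hb) hb.symm⟩)
  · -- the solid tori are pairwise disjoint because the handle pieces are
    intro i j hij
    refine Set.disjoint_left.2 ?_
    rintro _ ⟨b, rfl⟩ ⟨b', hb'⟩
    have h := congrArg bP.incl hb'
    rw [hinclB, hinclB] at h
    exact Set.disjoint_left.1 (hBdisj hij) (mem_range_self _) ⟨_, h⟩
  · -- the relation
    have hxi : x.1 ∉ range (L.component i) := (Link.mem_complement_iff L x.1).1 x.2 i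
    rw [show Link.surgeryRel ν i x b ↔ surgeryRel (ν i) ⟨x.1, hxi⟩ b from Iff.rfl,
      ← (g i).glueRel_incl_beltBoundaryPt_iff (ν i) (hbd i) ⟨x.1, hxi⟩ b]
    have key : jA₀ x = jB₀ i b ↔ jA (linkComplementPt g ν hbd x) = jB i (beltBoundaryPt b) := by
      constructor
      · intro h
        have := congrArg bP.incl h
        rwa [hinclA, hinclB] at this
      · intro h
        apply bP.injective_incl
        rw [hinclA, hinclB]
        exact h
    exact key.trans (hglue i _ _)

end Link

end Literature.Topology.FourManifolds
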